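import Mathlib
import HarnessLib
import HarnessLib.Audit
import Summits.NavierStokesRegularity.Statement
import Literature.Analysis.FluidPDE.ClassicalSolution
import Literature.Analysis.FluidPDE.LerayHopf
import Literature.Analysis.FluidPDE.SuitableWeak
import Literature.Analysis.FluidPDE.NSWave0
import Summits.NavierStokesRegularity.NavierStokesRegularity.Theorems.NoBlowupToClay
import Summits.NavierStokesRegularity.NavierStokesRegularity.Theorems.QuarterJoltNoEnergyAtom
import Summits.NavierStokesRegularity.NavierStokesRegularity.Theses.TypeICertificateLadder
import HarnessLib.Audit.Status.Attr

/-!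
Route: RootDecompTerminalEnergy

# Route RootDecompTerminalEnergy — Root decomposition g0 — Clay (A) ⟸ NoTypeI ∧ no energy atom ∧
atom-free blow-up is tame ∧ no tame Type II

ROOT DECOMPOSITION CELL decomp-ns (D-0178/D-0179, RESIDUAL MODE, blocker-first), generation 0,
route-writer decomp-ns-writer-1: the THREE-CELL LATTICE under blocker B1 = stmt-0056 NoTypeII booked
by the critic (CRITIC-LEDGER row 7, HOME/STATUS.md CLEARED 2026-08-30T01:32:55Z: «WRITER: book ONE
three-cell lattice under B1 {atomic collapse → P2; diffuse dust → J1; tame Type II → E₂ = lens-6},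
with E₁ = existing shelf item 18118 (dedup)») = the common refinement of two critic-CLEARED lens
nodes: lens 6 TerminalEnergyDefect (CLEARED 2026-08-30T01:23:13Z «one-cell carving of B1»; file
HOME/decomp-ns-lens-6/TerminalEnergyDefect.lean sha256
69012a63cdafec53d8d0f993dd54f9695fbd57fd2b560798469b4a7dc88f3f9b) and lens 2 EnergyAtomDichotomy
(CLEARED 2026-08-30T01:32:55Z «one-cell carving of B1 at the atomic level»; file
HOME/decomp-ns-lens-2/EnergyAtomDichotomy.lean sha256
345c59877daee6f46fe84ef2ea9f19d1316b7d91ae969b26915c2bb6244d5719); census data file of record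
HOME/census/COSTUME-CENSUS-v1.json sha256
220d7422001a479cf9e551e3ac99b4e2a379c951b20daec6aa2269ee429a400a (HOME =
run/shared/lean/pub/decomp-ns). TREE: ROOT `NavierStokesRegularity` (Clay (A)) ⟸[EQUIV E0, landed
`navierStokesRegularity_iff_noBlowup`] NoBlowup ⟸[AND A0, free seam] NoTypeI (P1 = stmt-1217, frame
RESIDUAL) ∧ NoTypeII (B1 = stmt-0056) and B1 ⟺[kernel `noTypeII_iff_threeCells`, exact modulo the
LANDED LS18 Thm 1.2 `Theorems.NoTerminalJolt.tendsto_eLpNorm_sub_of_isTypeIBlowup`] P2 NoEnergyAtom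
∧ J1 AtomFreeBlowupIsTame ∧ E₂ NoTameTypeII, with the coarser cleared pieces E₁ = NoWildBlowup ⟺ P2
∧ J1 (= shelf item stmt-18118 `HodographBetchov.NoFastEnergyConcentration`, kernel
`noWildBlowup_iff_atomSplit` + landed `typeIIEnergyEquality_iff_noFastEnergyConcentration`) and P3 =
AtomFreeBlowupIsTypeI ⟺ J1 ∧ E₂-on-atom-free. It suffices to show X = P1 ∧ P2 ∧ J1 ∧ E₂: no Type-I
blow-up for Clay data (residual by name), no energy ATOM at a frame time (the ATTACKED cell), an
atom-free first blow-up deposits no terminal energy defect at all (residual, diffuse-dust cell), and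
a defect-free first blow-up has the Type-I rate (residual, B1's weight). Why this is novel: no route
of the census (COSTUME-CENSUS-v1.json sha256
220d7422001a479cf9e551e3ac99b4e2a379c951b20daec6aa2269ee429a400a) uses the Lebesgue type of the
TERMINAL ENERGY MEASURE of a Clay blow-up as the splitting axis of the blocker 0056 — the lattice
{atom | dust | tame} puts the Type-I energy law (LS18 Thm 1.2, landed) and ε-regularity to work on
one typed ATTACKABLE cell (P2, with landed in-NS rungs) and isolates the two idea-less cells (J1,
E₂) as DECLARED RESIDUALS instead of one @[hard_core].
Lean: `NoTypeIBlowup ∧ NoEnergyAtom ∧ AtomFreeBlowupIsTame ∧ NoTameTypeII`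

## Assembly
Pure logic over the landed frame stmt-0055 (`Theorems.navierStokesRegularity_of_noBlowup`: Leray
1934, Kato 1984, Prodi–Serrin, Lemarié-Rieusset 2016 Thm 15.1, PROVED and discharged inside
`closes`, not assumed): given a classical Leray–Hopf solution on [0,T) from a rapidly decaying
datum, either it extends past T or it is maximal; then P2 says it has no atom at T, J1 makes it
energy-continuous into T, E₂ gives the Type-I rate, and P1 extends it past T anyway — contradiction;
hence NoBlowup; hence Clay (A). Deciding theorem `closes : NoTypeIBlowup → NoEnergyAtom →
AtomFreeBlowupIsTame → NoTameTypeII → NavierStokesRegularity`, kernel-checked in the writer's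
Sketch2.lean (rc 0, 0 sorry, axioms propext/Classical.choice/Quot.sound), every binder load-bearing;
evidence lemmas (not items) in the same sketch: `noTypeII_iff_threeCells`,
`noWildBlowup_iff_atomSplit`, `noEnergyAtom_of_noBlowup`, `noEnergyAtom_rung_typeI`.

Rationale: WHY THIS LINE. The cut axis is Leslie–Shvydkoy's TERMINAL ENERGY MEASURE ℰ = w*-lim_{t↑T}|u(t)|²dx =
|u(T)|²dx + θ_atomic + θ_diffuse at a first blow-up time (arXiv:1705.04420 §1.3): the cells «θ has
an atom» / «θ diffuse ≠ 0» / «θ = 0 but Type II» exhaust NoTypeII by excluded middle, are pairwise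
distinct, none is a symmetry image of another, and every piece is S-necessary (P1, J1, E₂ by
vacuity; P2 by the kernel chain NoBlowup ⇒ NoTypeII ⇒ P2 through the landed
`Theorems.NoTerminalJolt.noEnergyAtom_of_typeIIEnergyEquality`). P2 is strictly WEAKER with in-NS
separating classes that are THEOREMS while 0056 and S are open: sup-rate β < 3/5 (landed
`Literature.Analysis.FluidPDE.leslieShvydkoy2018_noConcentration_of_rate`, LS18 Prop 3.2/4.2), Type
I (landed `Theorems.NoTerminalJolt.noEnergyAtom_of_isTypeIBlowup`), enstrophy rate α < 4/5, L⁴ₜL⁴ₓ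
(Lions); it is ATTACKABLE by inheritance of the Leslie–Shvydkoy/CKN engine (local pressure
inequality of the EXACT equation, 𝓗¹(Σ_T)=0, CKN1982) — LS18 Question 1.1 at dimension 0 — and
INSTRUMENTABLE (Leray-energy exponent test β ≥ 3/5 ⟺ atom possible; Tao energy-band test on
arXiv:1402.0290 §6). The two residual cells are where the catalogued barriers bite: E₂ is NSI-loaded
by the tree witness `Literature.Barriers.NavierStokesRegularity.NSITypeIIBlowup` (defect-free
Type-II blow-up of the NS inequality, arXiv:1709.00602 §5.5) and expected Tao-loaded; J1 (no diffuse
dust) has no construction against it even in the NSI relaxation (Scheffer–Ożański cascades are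
defect-free, arXiv:1809.02109 p.8) but no tool for it either. Imported area: none beyond NS energy
methods and GMT of measures on 𝓗¹-null sets — honest labels IDEA-NEEDED on J1/E₂. What it does that
prior routes do not: no item among the sub-problem's Theses cuts NoTypeII/NoBlowup along the
Lebesgue decomposition of the terminal energy measure; «no atom» exists in the tree only as a stub
below a sufficiency criterion (crux 19625) and «energy equality at blow-up» only as shelf item 18118
— here they become S-necessary CELLS of the blocker with typed complements and kernel-exact seams.

RANKED CRUXES. #2 NoEnergyAtom (crux) — P2 — NO ENERGY ATOM AT A FRAME TIME [the ATTACKED cell; =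
registered stub `stub_noEnergyAtom` of crux stmt-19625 (Cruxes/WeakLambdaCriterion/Lines/birth.lean)
VERBATIM, reused not re-invented; tag WEAKER(evidence: 0056 ⇒ P2 KERNEL
`noEnergyAtom_of_typeIIEnergyEquality`; S ⇒ P2 KERNEL (critic `noEnergyAtom_of_root`, writer
`noEnergyAtom_of_noBlowup`); in-NS separating classes where P2 is a THEOREM: rate β<3/5
`leslieShvydkoy2018_noConcentration_of_rate`, Type I `noEnergyAtom_of_isTypeIBlowup`, enstrophy
α<4/5 `noEnergyAtom_of_enstrophyRate` — critic CLEARED 2026-08-30T01:32:55Z, CRITIC-LEDGER row 7);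
leaf ATTACKABLE-by-inheritance (LS18/CKN engine; open = LS18 Question 1.1 at dimension 0,
arXiv:1705.04420 p.4) + INSTRUMENTABLE (exponent test: an atom needs sup-rate β ≥ 3/5 and core
radius γ ≤ 2β/3; Tao band test); BC5 rung LANDED: Type-I case
`Theorems.NoTerminalJolt.noEnergyAtom_of_isTypeIBlowup`]: a classical NS solution on ℝ³×[0,T) (zero
force), Leray–Hopf on [0,T] from its rapidly decaying datum, deposits no energy atom at time T: ∀x₀
∀η>0 ∃r>0, ∫_{B_r(x₀)}|u(t)|² < η for all t<T close to T. [difficulty: open-problem] (why it might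
fail: an energy-carrying point collapse at or above the Leray-energy rate (T−t)^{-3/5} (the NS
shadow of a single-point cascade, Tao arXiv:1402.0290) produces an atom; nothing in print excludes
it (LS18 Question 1.1).) [arXiv:1705.04420, arXiv:1402.0290, CKN1982, arXiv:2107.04157]
#3 NoTameTypeII (crux) — E₂ — NO TAME TYPE-II BLOW-UP [= lens-6 piece ContinuousBlowupIsTypeI in the
tree's `Tendsto` typing = lens-2 J2 VERBATIM; RESIDUAL cell carrying B1's weight (critic bookings
«B1 CARVED: atom/defect cell → E₁, weight → E₂», CLEARED 2026-08-30T01:23:13Z, and row 7); tag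
WEAKER(evidence: 0056 ⇒ E₂ kernel restriction; S ⇒ E₂ by vacuity; omitted cells = atomic collapse
and diffuse dust, both alive) with «difficulty distributed» UNDECIDED — stated test T6a (critic):
exhibit inside NS any implication «maximal ∧ Leray–Hopf ∧ L²-continuous into T ⊢ a degree-0 bound or
an excluded Type-II rate window» — YES ⇒ distributed, NO ⇒ E₂ ≡ 0056 off the defect cells; leaf
IDEA-NEEDED + BARRIER (NSI-loaded by tree
`Literature.Barriers.NavierStokesRegularity.NSITypeIIBlowup`; Tao-loaded pending test T2/T-Tao) +
INSTRUMENTABLE (exponent test on candidates, Hou arXiv:2107.06509); never ATTACKABLE — not a prover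
target]: a maximal smooth solution with lifespan T, Leray–Hopf from a rapidly decaying datum, with
‖u(t) − u(T)‖_{L²} → 0 as t ↑ T, blows up at the Type-I rate. [deps: NoEnergyAtom,
AtomFreeBlowupIsTame] [difficulty: open-problem] (why it might fail: the NS inequality admits a
defect-free Type-II first blow-up (tree NSITypeIIBlowup, arXiv:1709.00602 §5.5), Tao's averaged
blow-up is Type II, and Hou's axisymmetric candidate (arXiv:2107.06509) is tame: a proof must use
the exact equation.) [arXiv:1709.00602, arXiv:1402.0290, arXiv:2107.06509, KNSS2009]
#4 AtomFreeBlowupIsTame (crux) — J1 — AN ATOM-FREE FIRST BLOW-UP IS TAME [lens-2 J1 VERBATIM;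
RESIDUAL diffuse-dust cell; tag WEAKER(evidence: E₁/18118 ⇒ J1 trivially, 0056 ⇒ J1 kernel via LS18
Thm 1.2 landed; separating classes: atomic collapses and tame Type-II spikes, alive; omitted cell
never constructed even in the NSI relaxation — Scheffer/Ożański cascades are defect-free); leaf
IDEA-NEEDED (GMT of the energy measure on the compact 𝓗¹-null singular slice Σ_T + dynamics; no
named engine) — critic CLEARED 2026-08-30T01:32:55Z row 7 as the middle cell]: a maximal smooth
solution with lifespan T, Leray–Hopf from a rapidly decaying datum, which deposits no energy atom at
T, has ‖u(t) − u(T)‖_{L²} → 0 as t ↑ T (NS cannot smear a positive energy quantum over an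
uncountable 𝓗¹-null dust). [deps: NoEnergyAtom] [difficulty: open-problem] (why it might fail: a
diffuse-defect cascade depositing energy on a Cantor dust ⊂ Σ_T (𝓗¹-null but uncountable) is
compatible with SEI/LEI/CKN; no NS mechanism is known to forbid it.) [arXiv:1705.04420,
arXiv:1809.02109, CKN1982, doi:10.1007/s00220-011-1336-4]
#5 NoTypeIBlowup (crux) — P1 — FRAME RESIDUAL, NO TYPE-I BLOW-UP FOR CLAY DATA =
stmt-NavierStokesRegularity-1217 (`TypeICertificateLadder.NoTypeIBlowup` ≡ `ThreadingFlux.Target`,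
@[hard_core]) VERBATIM so that the ledger de-duplicates this item onto the existing one; declared
`residual` (tag KNOWN WEAKER than S: separating class = axisymmetric data — Type I excluded by
`knss_no_axisymmetric_typeI_holds` KNSS2009 / SereginSverak2009 while axisymmetric-with-swirl
regularity is open; census C02); owned by routes TypeICertificateLadder / ThreadingFlux /
TypeILiouville with live lines (lens-5 node SimilarityHorizon refines it further, pending critic);
leaf BARRIER-adjacent (`AveragedTypeIBlowup`: abstract Type-I exclusion is false; evasion = ESS
backward uniqueness)]: every classical solution of unforced NS on ℝ³×[0,T), Leray–Hopf on [0,T] from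
a rapidly decaying datum, with the Type-I rate at T, extends smoothly past T. [difficulty:
open-problem] (why it might fail: one Type-I (e.g. backward discretely self-similar) blow-up profile
for a Clay datum refutes it; the Liouville conjectures (L)/(L′) it is usually reduced to are open
and the averaged/dyadic models DO blow up at Type-I rate.) [KNSS2009, SereginSverak2009,
AlbrittonBarker2019, arXiv:1402.0290]

TWO-LAYER PLAN. P2 ⇐ {A: LOCAL ENERGY BUDGET on balls for the classical solution on [0,T) (cut-off
local energy inequality with pressure, lintegral form: ∫_{B_r(x₀)}|u(t)|² ≤ ∫_{B_{2r}(x₀)}|u(t₁)|² +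
C/r ∫_{t₁}^{T}∫_{B_{2r}}(|u|³+|p||u|) + Cν/r² ∫∫|u|² — provable-now, size M), B: VANISHING TERMINAL
INFLOW INTO POINTS (for every x₀, η and constant C there are r, t₁ with slice energy on B_{2r} at t₁
plus the C-scaled inflow after t₁ below η — the research stub; LS18 get it from the rate)} with glue
A → B → P2 (birth skeleton bc/NoEnergyAtom_birth.lean, stubs stub_localEnergyBudget /
stub_vanishingTerminalInflow, composition noEnergyAtom_of kernel-checked); rungs of P2 in kernel:
Type I (`noEnergyAtom_of_isTypeIBlowup`), rate β<3/5 (`leslieShvydkoy2018_noConcentration_of_rate`),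
enstrophy α<4/5. Nothing of this is filed now. J1, E₂, P1 are residuals and are not decomposed here
(P1's ladder lives under TypeICertificateLadder / ThreadingFlux / doors / (L); lens-5
SimilarityHorizon pending).

KILL CRITERIA. A first-time blow-up of a classical Leray–Hopf solution from a rapidly decaying datum
depositing an energy ATOM refutes P2 (close --reason refuted:NoEnergyAtom) — it must have sup-rate β
≥ 3/5 (below that P2 is a theorem), so the refuters' Type-I/DSS stock cannot touch it; a
diffuse-dust defect refutes J1, a tame Type-II blow-up refutes E₂, a Type-I blow-up refutes P1 —
each together with Clay (A). Critic test T6a answered NO re-scores E₂ as «B1 minus the two defect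
cells» (bookkeeping of the carving stands, no halving of B1 claimed). Test T-Tao (e_∞ > 0 from the
printed band of arXiv:1402.0290 §6) answered YES marks P2 Tao-LOADED (then the only attack is
exact-equation structure beyond energy identity + scaling: the local pressure law) — recorded, not a
kill. Proved elsewhere that moots it: stmt-0056 (then P2, J1, E₂ follow in kernel) or stmt-0054
NoBlowup.

NOT DECOMPOSED YET. J1 (IDEA-NEEDED diffuse-dust cell), E₂ (B1's weight) and P1 (hard core 1217) are
deliberately not decomposed; the LS18 mechanism behind P2 is layer 2 (above); the cell tests T1 (NSI
energy-conserving focusing block vs printed gain margin K ≤ 1.2159), T2/T-Tao (is Tao's cascade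
atom-free / defect-free at T*), T6a (critic) decide the UNDECIDED tags and are census/refuter
business, not items; E₁ = stmt-18118 and P3 = AtomFreeBlowupIsTypeI are the coarser cleared pieces,
recorded by kernel joins, not re-filed.

CHEAPEST FALSIFIER. Lookup already run by lenses 2/6 and the critic: is «no energy atom / energy
equality at the first blow-up time» decided in print? — NO: Leslie–Shvydkoy 2018 Question 1.1
(arXiv:1705.04420 p.4) is open; Thm 1.2 / Prop 3.2+4.2 settle only sup-rate β < 3/5 (landed in
tree); Chae–Wolf's no-atom theorem is for Euler under a rate. Next cheapest (≤ 1 h paper reading):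
the Tao energy-band test T-Tao on arXiv:1402.0290 §6 — either outcome leaves the node standing and
only fixes which cell is Tao-loaded.

NUMBERS. Items at open: 5 (4 cruxes + assembly); load-bearing binders of `closes`: 4 (P2 attacked;
J1, E₂, P1 declared residual). Constants: Leray-energy rate exponent 3/5 and core-radius law R ∼
(T−t)^{2/5} (atom threshold; LS18 Prop 3.2, q > 5/3 in the landed
`leslieShvydkoy2018_noConcentration_of_rate`); enstrophy threshold 4/5; Serrin pair for L⁴ₜL⁴ₓ
2/4+3/4 = 5/4 > 1; NSI Type-II window β ∈ (1/2, 0.512], gain K ≤ 1.2159 (arXiv:1709.00602 §5.5); Tao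
cascade energy band (1+ε₀)^{∓n/100} (arXiv:1402.0290 §6). kit: 0 core-h (writer kit_allowed=false;
census instrument menu in COSTUME-CENSUS-v1 block H).

DEFINITION REQUESTS. None: every item is stated over existing declarations (the lens helper
predicates are inlined; E₁'s vendored `LS18TypeIEnergyLaw` is dropped for the landed
`Theorems.NoTerminalJolt.tendsto_eLpNorm_sub_of_isTypeIBlowup`, critic row 7). Literature want open
elsewhere in the cell: acq-14832 (Yang 2024, axisymmetric energy equality; lens 2), non-blocking.

Novelty: Searches (2026-08-30, lenses 2/6 + critic + writer): rg «energy equality|anomalous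
dissipation|defect|atom|NoFastEnergyConcentration» over the sub's Theses/ and Cruxes/ (hits: shelf
item 18118 HodographBetchov.NoFastEnergyConcentration; stub_noEnergyAtom of crux 19625; QuarterJolt
NoTerminalJolt theorems — no S-necessary cell of 0056); `lit search --hybrid "energy equality first
blow-up time Navier-Stokes"`, `lit read arxiv:1705.04420 --grep` ([corpus: arxiv:1705.04420 p.4–6,
15–17]: Q1.1, Thm 1.2, Prop 3.2); [corpus: arxiv:2107.04157 p.1–5]; [corpus: paper:arxiv-1706.02020]
Chae–Wolf (Euler, rate); `lit galaxy search "energy equality|anomalous dissipation|first blow-up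
time" --star pdf` and "Shvydkoy" — no further relevant hits (named null); census COSTUME-CENSUS-v1
blocks A–C: no ≡S costume matches (P2 is not a known regularity criterion; no piece is S minus a
proved class; C12 scaled-energy Type I is a different notion).
Nearest prior art found: arXiv:1705.04420 (Leslie–Shvydkoy 2018: energy measure, no atoms below rate
3/5, Question 1.1) and in tree shelf item stmt-18118 / stub of crux 19625 / route TerminalTrace
(degree-0 trace density cut).
Delta: the Lebesgue decomposition of the terminal energy measure is promoted from corollary/stub
status to an exact three-cell carving of the blocker 0056 whose attacked cell (no atom) has landed
in-NS rungs and whose two residual cells are the named barrier-loaded complements, the four pieces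
deciding Clay (A) in kernel — a root dec  [refs: 1705.04420, 2107.04157, arxiv:1705.04420, arxiv:2107.04157, paper:arxiv-1706.02020]

Barriers (technique_class: terminal-energy-measure, LEI, eps-regularity): - technique_class: terminal-energy-measure, LEI, eps-regularity
- Literature.Barriers.NavierStokesRegularity.TaoAveragedBlowup: P2 — UNDECIDED placement by the
stated test T-Tao (e_∞ of the printed cascade band): e_∞ = 0 ⇒ outside (averaged analogue holds on
the witness; engine = LS18 local pressure inequality, exact-equation structure the averaged B̃
lacks, arXiv:1402.0290 p.8), e_∞ > 0 ⇒ loaded and the bet is exactly that exact-equation structure;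
E₂ — expected LOADED (Tao's blow-up is Type II and, granted T2, defect-free): declared residual, not
attacked; J1 — not in its class (no averaged construction deposits diffuse dust); P1 — loaded in
tree by `AveragedTypeIBlowup` (abstract Type-I exclusion false; evasion ESS backward uniqueness),
residual.
- Literature.Barriers.NavierStokesRegularity.NSITypeIIBlowup: E₂ — inside/loaded (the tree witness
is a defect-free Type-II first blow-up of the NS inequality ⇒ E₂'s proof must use the equation:
vorticity transport, backward uniqueness, exact u·∇u algebra) — residual; P2 and J1 — compatible
with every catalogued NSI witness (piece energies → 0, no defect, arXiv:1809.02109 p.8); whether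
SEI+LEI alone prove P2 is cell test T1 (energy-conserving focusing gain open in the NSI class).
- Literature.Barriers.NavierStokesRegularity.NavierStokesInequalitySingularSolution: same placement
as NSITypeIIBlowup (Scheffer–Ożański cascades are defect-free: P2/J1 compatible, E₂ loaded); P1's
NSI analogue is false (Type-I NSI cascade) — residual.
-

sub-problem: NavierStokesRegularity · status: open · opened planner-decomp-ns-writer-1-g0-0 2026-08-30T02:07:07Z · rev 0 · ledger route-NavierStokesRegularity-RootDecompTerminalEnergy
GENERATED by the gate from the ledger (D-0016/17). Provers cite these decls: `theorem foo : Summit.NavierStokesRegularity.NavierStokesRegularity.Theses.RootDecompTerminalEnergy.<Decl> := …` in Summits/NavierStokesRegularity/NavierStokesRegularity/Theorems/<Name>.lean.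
-/

namespace Summit.NavierStokesRegularity.NavierStokesRegularity.Theses.RootDecompTerminalEnergy

open scoped BigOperators Topology Manifold Classical MeasureTheory ProbabilityTheory Matrix InnerProductSpace ComplexConjugate ContinuousMap
open Filter Set Function TopologicalSpace MeasureTheory

attribute [summit_statement] _root_.NavierStokesRegularity

open Literature.NS

/-- item stmt-NavierStokesRegularity-24827 · crux · rank 2 · open · by planner
why it might fail: an energy-carrying point collapse at or above the Leray-energy rate (T−t)^{-3/5} (the NS shadow of a single-point cascade, Tao arXiv:1402.0290) produces an atom; nothing in print excludes it (LS18 Question 1.1).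
sources: arXiv:1705.04420, arXiv:1402.0290, CKN1982, arXiv:2107.04157
[crux] P2 — NO ENERGY ATOM AT A FRAME TIME [the ATTACKED cell; = registered stub `stub_noEnergyAtom`
of crux stmt-19625 (Cruxes/WeakLambdaCriterion/Lines/birth.lean) VERBATIM, reused not re-invented;
tag WEAKER(evidence: 0056 ⇒ P2 KERNEL `noEnergyAtom_of_typeIIEnergyEquality`; S ⇒ P2 KERNEL (critic
`noEnergyAtom_of_root`, writer `noEnergyAtom_of_noBlowup`); in-NS separating classes where P2 is a
THEOREM: rate β<3/5 `leslieShvydkoy2018_noConcentration_of_rate`, Type I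
`noEnergyAtom_of_isTypeIBlowup`, enstrophy α<4/5 `noEnergyAtom_of_enstrophyRate` — critic CLEARED
2026-08-30T01:32:55Z, CRITIC-LEDGER row 7); leaf ATTACKABLE-by-inheritance (LS18/CKN engine; open =
LS18 Question 1.1 at dimension 0, arXiv:1705.04420 p.4) + INSTRUMENTABLE (exponent test: an atom
needs sup-rate β ≥ 3/5 and core radius γ ≤ 2β/3; Tao band test); BC5 rung LANDED: Type-I case
`Theorems.NoTerminalJolt.noEnergyAtom_of_isTypeIBlowup`]: a classical NS solution on ℝ³×[0,T) (zero
force), Leray–Hopf on [0,T] from its rapidly decaying datum, deposits no energy atom at time T: ∀x₀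
∀η>0 ∃r>0, ∫_{B_r(x₀)}|u(t)|² < η for all t<T close to T. [difficulty: open-problem] -/
@[route_item "route-NavierStokesRegularity-RootDecompTerminalEnergy", crux]
def NoEnergyAtom : Prop :=
  ∀ (ν T : ℝ), 0 < ν → 0 < T → ∀ (u : ℝ → EuclideanSpace ℝ (Fin 3) → EuclideanSpace ℝ (Fin 3)) (p : ℝ → EuclideanSpace ℝ (Fin 3) → ℝ), Literature.Analysis.FluidPDE.IsClassicalNSSolutionOn (Set.Ico 0 T) ν 0 u p → Literature.Analysis.FluidPDE.IsLerayHopfOn T ν 0 (u 0) u → Literature.Analysis.FluidPDE.HasRapidSpatialDecay (u 0) → ∀ (x₀ : EuclideanSpace ℝ (Fin 3)) (η : NNReal), 0 < η → ∃ r : ℝ, 0 < r ∧ ∀ᶠ t in nhdsWithin T (Set.Iio T), ∫⁻ x in Metric.ball x₀ r, ‖u t x‖ₑ ^ 2 < (η : ENNReal)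

/-- item stmt-NavierStokesRegularity-24828 · crux · rank 3 · open · by planner
why it might fail: the NS inequality admits a defect-free Type-II first blow-up (tree NSITypeIIBlowup, arXiv:1709.00602 §5.5), Tao's averaged blow-up is Type II, and Hou's axisymmetric candidate (arXiv:2107.06509) is tame: a proof must use the exact equation.
sources: arXiv:1709.00602, arXiv:1402.0290, arXiv:2107.06509, KNSS2009
[crux] E₂ — NO TAME TYPE-II BLOW-UP [= lens-6 piece ContinuousBlowupIsTypeI in the tree's `Tendsto`
typing = lens-2 J2 VERBATIM; RESIDUAL cell carrying B1's weight (critic bookings «B1 CARVED: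
atom/defect cell → E₁, weight → E₂», CLEARED 2026-08-30T01:23:13Z, and row 7); tag WEAKER(evidence:
0056 ⇒ E₂ kernel restriction; S ⇒ E₂ by vacuity; omitted cells = atomic collapse and diffuse dust,
both alive) with «difficulty distributed» UNDECIDED — stated test T6a (critic): exhibit inside NS
any implication «maximal ∧ Leray–Hopf ∧ L²-continuous into T ⊢ a degree-0 bound or an excluded
Type-II rate window» — YES ⇒ distributed, NO ⇒ E₂ ≡ 0056 off the defect cells; leaf IDEA-NEEDED +
BARRIER (NSI-loaded by tree `Literature.Barriers.NavierStokesRegularity.NSITypeIIBlowup`; Tao-loaded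
pending test T2/T-Tao) + INSTRUMENTABLE (exponent test on candidates, Hou arXiv:2107.06509); never
ATTACKABLE — not a prover target]: a maximal smooth solution with lifespan T, Leray–Hopf from a
rapidly decaying datum, with ‖u(t) − u(T)‖_{L²} → 0 as t ↑ T, blows up at the Type-I rate. [deps:
NoEnergyAtom, AtomFreeBlowupIsTame] [difficulty: open-problem] -/
@[route_item "route-NavierStokesRegularity-RootDecompTerminalEnergy", crux]
def NoTameTypeII : Prop :=
  ∀ (ν T : ℝ), 0 < ν → 0 < T → ∀ (u : ℝ → EuclideanSpace ℝ (Fin 3) → EuclideanSpace ℝ (Fin 3)) (p : ℝ → EuclideanSpace ℝ (Fin 3) → ℝ), Literature.Analysis.FluidPDE.IsMaximalSmoothSolution ν 0 u p T → Literature.Analysis.FluidPDE.IsLerayHopfOn T ν 0 (u 0) u → Literature.Analysis.FluidPDE.HasRapidSpatialDecay (u 0) → Filter.Tendsto (fun t => MeasureTheory.eLpNorm (u t - u T) 2 MeasureTheory.volume) (nhdsWithin T (Set.Iio T)) (nhds 0) → Literature.Analysis.FluidPDE.IsTypeIBlowup u T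

/-- item stmt-NavierStokesRegularity-24829 · crux · rank 4 · open · by planner
why it might fail: a diffuse-defect cascade depositing energy on a Cantor dust ⊂ Σ_T (𝓗¹-null but uncountable) is compatible with SEI/LEI/CKN; no NS mechanism is known to forbid it.
sources: arXiv:1705.04420, arXiv:1809.02109, CKN1982, doi:10.1007/s00220-011-1336-4
[crux] J1 — AN ATOM-FREE FIRST BLOW-UP IS TAME [lens-2 J1 VERBATIM; RESIDUAL diffuse-dust cell; tag
WEAKER(evidence: E₁/18118 ⇒ J1 trivially, 0056 ⇒ J1 kernel via LS18 Thm 1.2 landed; separating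
classes: atomic collapses and tame Type-II spikes, alive; omitted cell never constructed even in the
NSI relaxation — Scheffer/Ożański cascades are defect-free); leaf IDEA-NEEDED (GMT of the energy
measure on the compact 𝓗¹-null singular slice Σ_T + dynamics; no named engine) — critic CLEARED
2026-08-30T01:32:55Z row 7 as the middle cell]: a maximal smooth solution with lifespan T,
Leray–Hopf from a rapidly decaying datum, which deposits no energy atom at T, has ‖u(t) − u(T)‖_{L²}
→ 0 as t ↑ T (NS cannot smear a positive energy quantum over an uncountable 𝓗¹-null dust). [deps:
NoEnergyAtom] [difficulty: open-problem] -/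
@[route_item "route-NavierStokesRegularity-RootDecompTerminalEnergy", crux]
def AtomFreeBlowupIsTame : Prop :=
  ∀ (ν T : ℝ), 0 < ν → 0 < T → ∀ (u : ℝ → EuclideanSpace ℝ (Fin 3) → EuclideanSpace ℝ (Fin 3)) (p : ℝ → EuclideanSpace ℝ (Fin 3) → ℝ), Literature.Analysis.FluidPDE.IsMaximalSmoothSolution ν 0 u p T → Literature.Analysis.FluidPDE.IsLerayHopfOn T ν 0 (u 0) u → Literature.Analysis.FluidPDE.HasRapidSpatialDecay (u 0) → (∀ (x₀ : EuclideanSpace ℝ (Fin 3)) (η : NNReal), 0 < η → ∃ r : ℝ, 0 < r ∧ ∀ᶠ t in nhdsWithin T (Set.Iio T), ∫⁻ x in Metric.ball x₀ r, ‖u t x‖ₑ ^ 2 < (η : ENNReal)) → Filter.Tendsto (fun t => MeasureTheory.eLpNorm (u t - u T) 2 MeasureTheory.volume) (nhdsWithin T (Set.Iio T)) (nhds 0)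

/-- item stmt-NavierStokesRegularity-1217 · crux · rank 5 · open · by planner
why it might fail: one Type-I (e.g. backward discretely self-similar) blow-up profile for a Clay datum refutes it; the Liouville conjectures (L)/(L′) it is usually reduced to are open and the averaged/dyadic models DO blow up at Type-I rate.
sources: KNSS2009, SereginSverak2009, AlbrittonBarker2019, arXiv:1402.0290
[target] X = NO TYPE-I BLOW-UP FOR CLAY DATA: a classical solution of unforced NS on ℝ³×[0,T) which
is Leray–Hopf from a rapidly decaying datum and blows up at most at the Type-I rate ‖u(t)‖∞ ≤
C(T−t)^{-1/2} extends smoothly past T. Equals UnthreadedNoBlowup ∧ ThreadedNoBlowup by excluded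
middle on 'every point is unthreaded' (proved in the planner's Sketch.lean: target_of_cruxes); it is
the unconditional conclusion of stmt-NavierStokesRegularity-0058 (route TypeILiouville, which
assumes (L)). With NoTypeII (stmt-0056) it gives NoBlowup (stmt-0054). Card:
threading-flux-trace-topology. -/
@[route_item "route-NavierStokesRegularity-RootDecompTerminalEnergy", crux]
def NoTypeIBlowup : Prop :=
  ∀ (ν T : ℝ), 0 < ν → 0 < T → ∀ (u : ℝ → EuclideanSpace ℝ (Fin 3) → EuclideanSpace ℝ (Fin 3)) (p : ℝ → EuclideanSpace ℝ (Fin 3) → ℝ), Literature.Analysis.FluidPDE.IsClassicalNSSolutionOn (Set.Ico 0 T) ν 0 u p → Literature.Analysis.FluidPDE.IsLerayHopfOn T ν 0 (u 0) u → Literature.Analysis.FluidPDE.HasRapidSpatialDecay (u 0) → Literature.Analysis.FluidPDE.IsTypeIBlowup u T → Literature.Analysis.FluidPDE.HasSmoothExtensionPast ν 0 u T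

/-- item stmt-NavierStokesRegularity-24830 · assembly · rank 1 · open · by planner
sources: arXiv:1705.04420, Fefferman2000, LemarieRieusset2016
[assembly] P1 → P2 → J1 → E₂ → Clay (A): exactly the type of the deciding theorem `closes` (hence
provable in one line once the route file exists). -/
@[route_item "route-NavierStokesRegularity-RootDecompTerminalEnergy"]
def Assembly : Prop :=
  NoTypeIBlowup → NoEnergyAtom → AtomFreeBlowupIsTame → NoTameTypeII → NavierStokesRegularity

/-! D-0027 §2.1 — DECIDING THEOREM (planner-authored via `route open/edit --closes-file`; by planner-decomp-ns-writer-1-g0-0 2026-08-30T02:07:07Z):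
its hypotheses are this route's items and its conclusion the sub-problem Statement (glue_lint), and it elaborates with this file. -/

@[closes "route-NavierStokesRegularity-RootDecompTerminalEnergy"] theorem closes (hI : NoTypeIBlowup) (hA : NoEnergyAtom) (hJ1 : AtomFreeBlowupIsTame) (hJ2 : NoTameTypeII) : _root_.NavierStokesRegularity := by
  refine Summit.NavierStokesRegularity.NavierStokesRegularity.Theorems.navierStokesRegularity_of_noBlowup ?_
  intro ν T hν hT u p hcl hLH hdec
  by_contra hext
  exact hext (hI ν T hν hT u p hcl hLH hdec (hJ2 ν T hν hT u p ⟨hcl, hext⟩ hLH hdec (hJ1 ν T hν hT u p ⟨hcl, hext⟩ hLH hdec (hA ν T hν hT u p hcl hLH hdec))))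

end Summit.NavierStokesRegularity.NavierStokesRegularity.Theses.RootDecompTerminalEnergy
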